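import Literature.Barriers.CriticalPhenomena.WeaklySAWGaussianConvolution
import Literature.Barriers.CriticalPhenomena.WeaklySAWFluctuationDegreeZero
import Literature.MathematicalPhysics.QuantumLattice.GrassmannGaussianConvolution
import HarnessLib

/-!
# BBS 2015, Proposition 5.1: `E_{C'+C₁}θ F = (E_{C'}θ ∘ E_{C₁}θ) F` for all forms `F`

Bauerschmidt–Brydges–Slade, CMP 337 (2015), arXiv:1403.7422, §5.1, Proposition 5.1: "Let
`F ∈ 𝒩(Λ)`, and suppose that `C₁` and `C'` are `Λ × Λ` matrices with positive-definite Hermitian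
parts. Then `E_{C'+C₁}θF = (E_{C'}θ ∘ E_{C₁}θ)F`." (the basis of the progressive integration
`Z_N = E_{C_N}θ ∘ ⋯ ∘ E_{C₁}θ Z₀`, (5.2)–(5.3)). This file proves it for the map
`E_Cθ = convTheta A` (`C = A⁻¹`) of `WeaklySAWFluctuationIntegral.lean`, for real symmetric
positive-definite `A₁, A₂` (the case of the covariance decompositions of the sequel) and every form
`F` whose coefficients are continuous of polynomial growth:

* `coeffMap_gaussConvOn` (change of coefficient ring commutes with the fermionic convolution `Γ` of
  `GrassmannGaussianConvolution.lean`), `fermiKernel A T T'` (the matrix of `Γ_{Aᵀ}` on monomials,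
  complex numbers) and **`sum_fermiKernel_mul_fermiKernel`** (its semigroup law, from
  `gaussConvOn_gaussConvOn_dbl`);
* **`convTheta_eq_sum`** — the structure of `E_Cθ` on a general form `F = Σ_u f_u θ_u`:
  `E_Cθ F = Σ_s (Σ_u ε (det A)⁻¹ fermiKernel A u s · μ_C * f_u) θ_s` (bosonic Gaussian convolution
  of the coefficients, eq. (4.22), times the fermionic Gaussian moments);
* **`convTheta_convTheta`**: `E_{C₂}θ (E_{C₁}θ F) = E_{C₁+C₂}θ F` with `C_i = A_i⁻¹`,
  `C₁ + C₂ = (convMatrix A₁ A₂)⁻¹` (`inv_convMatrix`) — Proposition 5.1 — from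
  `gaussConvolution_gaussConvolution` (bosons) and `sum_fermiKernel_mul_fermiKernel` (fermions).

Everything is proved; no named facts. `-- TODO(general form):` complex `A_i` with positive-definite
Hermitian part.
-/

noncomputable section

/-! ### Generic complements: change of coefficients and the fermionic convolution -/

namespace Literature.MathematicalPhysics.QuantumLattice

section QLatticeAQFT

open ExteriorAlgebra GrassmannAlgebra

namespace GrassmannAlgebra

variable {R R' : Type*} [CommRing R] [CommRing R'] {J : Type*} [LinearOrder J] [Fintype J]
  {κ : Type*} [LinearOrder κ] [Fintype κ]

/-- `coeffMap` on degree-one elements. [folklore] -/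
theorem coeffMap_ι (σ : R →+* R') (v : J → R) :
    coeffMap σ (ExteriorAlgebra.ι R v) = ExteriorAlgebra.ι R' (σ ∘ v) := by
  rw [ι_eq_sum_gen R v, map_sum, ι_eq_sum_gen R' (σ ∘ v)]
  refine Finset.sum_congr rfl fun i _ => ?_
  rw [coeffMap_smul, coeffMap_gen, Function.comp_apply]

/-- **Change of coefficients commutes with partial Berezin integration.** [folklore] -/
theorem coeffMap_berezinOn (σ : R →+* R') (s : Finset J) (x : GrassmannAlgebra R J) :
    coeffMap σ (berezinOn R s x) = berezinOn R' s (coeffMap σ x) := by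
  conv_lhs => rw [← (grassmannBasis R J).sum_repr x]
  rw [coeffMap_apply σ x, map_sum, map_sum, map_sum]
  refine Finset.sum_congr rfl fun t _ => ?_
  rw [map_smul, coeffMap_smul, map_smul, berezinOn_grassmannBasis, berezinOn_grassmannBasis]
  split_ifs
  · rw [coeffMap_smul, coeffMap_grassmannBasis, map_intCast]
  · rw [map_zero]

/-- The coefficient change of a spectator is a spectator. [folklore] -/
theorem repr_eq_zero_of_mem_spectatorSubalgebra {s t : Finset J} {y : GrassmannAlgebra R J}
    (hy : y ∈ spectatorSubalgebra R s) (ht : ¬ Disjoint t s) : (grassmannBasis R J).repr y t = 0 := by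
  rw [mem_spectatorSubalgebra_iff] at hy
  induction hy using Submodule.span_induction with
  | mem z hz =>
    obtain ⟨u, hu, rfl⟩ := hz
    rw [Module.Basis.repr_self, Finsupp.single_apply, if_neg]
    rintro rfl; exact ht hu
  | zero => rw [map_zero, Finsupp.zero_apply]
  | add z w _ _ hz hw => rw [map_add, Finsupp.add_apply, hz, hw, add_zero]
  | smul r z _ hz => rw [map_smul, Finsupp.smul_apply, hz, smul_zero]

/-- Change of coefficients commutes with the embedding along an order embedding of generators.
[folklore] -/
theorem coeffMap_map_extendByZero (σ : R →+* R') (e : κ ↪o J) (x : GrassmannAlgebra R κ) :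
    coeffMap σ (ExteriorAlgebra.map (Function.ExtendByZero.linearMap R e) x) =
      ExteriorAlgebra.map (Function.ExtendByZero.linearMap R' e) (coeffMap σ x) := by
  induction x using CliffordAlgebra.induction with
  | algebraMap r =>
    change coeffMap σ (ExteriorAlgebra.map _ (algebraMap R (GrassmannAlgebra R κ) r)) =
      ExteriorAlgebra.map _ (coeffMap σ (algebraMap R (GrassmannAlgebra R κ) r))
    rw [AlgHom.commutes, coeffMap_algebraMap, coeffMap_algebraMap, AlgHom.commutes]
  | ι v =>
    change coeffMap σ (ExteriorAlgebra.map _ (ExteriorAlgebra.ι R v)) =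
      ExteriorAlgebra.map _ (coeffMap σ (ExteriorAlgebra.ι R v))
    rw [ExteriorAlgebra.map_apply_ι, coeffMap_ι, coeffMap_ι, ExteriorAlgebra.map_apply_ι]
    congr 1
    funext j
    simp only [Function.comp_apply, Function.ExtendByZero.linearMap_apply]
    rw [Function.apply_extend σ]
    congr 1
    funext i; exact map_zero σ
  | mul a b ha hb => rw [map_mul, map_mul, ha, hb, map_mul, map_mul]
  | add a b ha hb => rw [map_add, map_add, ha, hb, map_add, map_add]

variable {ι' : Type*} [LinearOrder ι'] [Fintype ι']

/-- Change of coefficients commutes with the field-sum substitution `ψ₀ ↦ ψ₀ + ψ₁`. [folklore] -/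
theorem coeffMap_map_one_add_fieldShift (σ : R →+* R') (e₀ e₁ : ι' ⊕ₗ ι' ↪o J) (x : GrassmannAlgebra R J) :
    coeffMap σ (ExteriorAlgebra.map (1 + fieldShift R e₀ e₁) x) =
      ExteriorAlgebra.map (1 + fieldShift R' e₀ e₁) (coeffMap σ x) := by
  induction x using CliffordAlgebra.induction with
  | algebraMap r =>
    change coeffMap σ (ExteriorAlgebra.map _ (algebraMap R (GrassmannAlgebra R J) r)) =
      ExteriorAlgebra.map _ (coeffMap σ (algebraMap R (GrassmannAlgebra R J) r))
    rw [AlgHom.commutes, coeffMap_algebraMap, AlgHom.commutes]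
  | ι v =>
    change coeffMap σ (ExteriorAlgebra.map _ (ExteriorAlgebra.ι R v)) =
      ExteriorAlgebra.map _ (coeffMap σ (ExteriorAlgebra.ι R v))
    rw [ExteriorAlgebra.map_apply_ι, coeffMap_ι, coeffMap_ι, ExteriorAlgebra.map_apply_ι]
    congr 1
    funext j
    simp only [Function.comp_apply, LinearMap.add_apply, Module.End.one_apply, Pi.add_apply, map_add,
      fieldShift_apply, Finset.sum_apply, Pi.smul_apply, smul_eq_mul, map_sum, map_mul, Pi.single_apply,
      apply_ite σ, map_one, map_zero]
  | mul a b ha hb => rw [map_mul, map_mul, ha, hb, map_mul, map_mul]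
  | add a b ha hb => rw [map_add, map_add, ha, hb, map_add, map_add]

/-- `coeffMap` fixes the fermion generators `ψ̄ᵢ`. [folklore] -/
theorem coeffMap_psiBar_gen (σ : R →+* R') (i : ι') : coeffMap σ (psiBar R i) = psiBar R' i := by
  unfold psiBar; exact coeffMap_gen σ _

/-- `coeffMap` fixes the fermion generators `ψᵢ`. [folklore] -/
theorem coeffMap_psi_gen (σ : R →+* R') (i : ι') : coeffMap σ (psi R i) = psi R' i := by
  unfold psi; exact coeffMap_gen σ _

/-- Change of coefficients on the Gaussian exponent: `σ_*(ψ̄Mψ) = ψ̄ σ(M) ψ`. [folklore] -/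
theorem coeffMap_quadratic (σ : R →+* R') (M : Matrix ι' ι' R) :
    coeffMap σ (quadratic R M) = quadratic R' (M.map σ) := by
  rw [quadratic, quadratic, map_sum]
  refine Finset.sum_congr rfl fun i _ => ?_
  rw [map_sum]
  refine Finset.sum_congr rfl fun j _ => ?_
  rw [coeffMap_smul, map_mul, Matrix.map_apply, coeffMap_psiBar_gen, coeffMap_psi_gen]

end GrassmannAlgebra

section ConvolutionCoeff

variable {R R' : Type*} [CommRing R] [CommRing R'] [Algebra ℚ R] [Algebra ℚ R']
  {ι : Type*} [LinearOrder ι] [Fintype ι] {J : Type*} [LinearOrder J] [Fintype J]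

/-- **Change of coefficients commutes with the fermionic convolution**:
`σ_*(Γ_A x) = Γ_{σ(A)}(σ_* x)`. [folklore] -/
theorem coeffMap_gaussConvOn (σ : R →+* R') (e₀ e₁ : ι ⊕ₗ ι ↪o J) (A : Matrix ι ι R) (x : GrassmannAlgebra R J) :
    coeffMap σ (gaussConvOn R e₀ e₁ A x) = gaussConvOn R' e₀ e₁ (A.map σ) (coeffMap σ x) := by
  rw [gaussConvOn, gaussConvOn, coeffMap_berezinOn, map_mul, coeffMap_map_extendByZero,
    coeffMap_grassmannExp σ (isNilpotent_quadratic R A), coeffMap_quadratic, coeffMap_map_one_add_fieldShift]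

/-- `Γ` is linear: finite linear combinations. [folklore] -/
theorem gaussConvOn_sum_smul {α : Type*} (S : Finset α) (c : α → R) (x : α → GrassmannAlgebra R J)
    (e₀ e₁ : ι ⊕ₗ ι ↪o J) (A : Matrix ι ι R) :
    gaussConvOn R e₀ e₁ A (∑ i ∈ S, c i • x i) = ∑ i ∈ S, c i • gaussConvOn R e₀ e₁ A (x i) := by
  rw [gaussConvOn, map_sum, Finset.mul_sum, map_sum]
  refine Finset.sum_congr rfl fun i _ => ?_
  rw [map_smul, mul_smul_comm, map_smul, gaussConvOn]

/-- `Γ x` expanded in the monomial basis has no coefficients meeting the fluctuation block. [folklore] -/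
theorem repr_gaussConvOn_eq_zero (e₀ e₁ : ι ⊕ₗ ι ↪o J) (A : Matrix ι ι R) (x : GrassmannAlgebra R J)
    {t : Finset J} (ht : ¬ Disjoint t (Finset.univ.map e₁.toEmbedding)) :
    (grassmannBasis R J).repr (gaussConvOn R e₀ e₁ A x) t = 0 :=
  repr_eq_zero_of_mem_spectatorSubalgebra (gaussConvOn_mem_self R e₀ e₁ A x) ht

end ConvolutionCoeff

end QLatticeAQFT

end Literature.MathematicalPhysics.QuantumLattice

/-! ### Proposition 5.1 -/

open MeasureTheory Complex ComplexConjugate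
open Literature.MathematicalPhysics.QuantumLattice
open Literature.MathematicalPhysics.QuantumLattice.GrassmannAlgebra (berezin gen coeffMap grassmannBasis berezinOn)
open scoped BigOperators

namespace Literature.Barriers.CriticalPhenomena

namespace CTWSAW

section Progressive

variable {Λ : Type*} [LinearOrder Λ] [Fintype Λ]

/-- Complex constants as `0`-form coefficients of `𝒩^×`. [folklore] -/
def constHom₂ : ℂ →+* FieldFun2 Λ := algebraMap ℂ (FieldFun2 Λ)

omit [LinearOrder Λ] [Fintype Λ] in
/-- Unfolding `constHom₂`. [folklore] -/
@[simp] theorem constHom₂_apply (z : ℂ) (p : (Λ → ℂ) × (Λ → ℂ)) : constHom₂ (Λ := Λ) z p = z := rfl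

/-- **The fermionic kernel of `E_Cθ`**: the coefficient of the monomial `θ_{T'}` in the fermionic
Gaussian convolution `Γ_{Aᵀ} θ_T = ∫ dη̄dη e^{-S_A(η)} θ_T(ψ ↦ ψ+η)` of the monomial `θ_T` of the
doubled algebra (complex coefficients; `e^{-ψAψ̄} = e^{ψ̄Aᵀψ}`). [folklore] -/
def fermiKernel (A : Matrix Λ Λ ℂ) (T T' : Finset (DGen Λ)) : ℂ :=
  (grassmannBasis ℂ (DGen Λ)).repr
    (gaussConvOn ℂ (blockPsi Λ) (blockEta Λ) A.transpose (grassmannBasis ℂ (DGen Λ) T)) T'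

/-! #### The Gaussian weight `e^{-S_A}` and `θ` in the language of `gaussConvOn` -/

/-- The `η`-block Gaussian of `e^{-S_A(ξ,η)}` is the transported `e^{η̄Aᵀη}` with constant
coefficients. [folklore] -/
theorem mapEta_coeffMap_grassmannExp_neg_fermionAction (A : Matrix Λ Λ ℂ) :
    mapEta (coeffMap fluctCoeff (grassmannExp (-fermionAction A))) =
      ExteriorAlgebra.map (Function.ExtendByZero.linearMap (FieldFun2 Λ) (blockEta Λ))
        (grassmannExp (quadratic (FieldFun2 Λ) (A.transpose.map (constHom₂ (Λ := Λ))))) := by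
  have hq : -fermionAction A = quadratic (FieldFun Λ) (constMat A.transpose) := by
    rw [fermionAction_eq_neg_quadratic, neg_neg]
  have hmap : (constMat (Λ := Λ) A.transpose).map fluctCoeff = A.transpose.map (constHom₂ (Λ := Λ)) := by
    ext i j p; rfl
  rw [hq, GrassmannAlgebra.coeffMap_grassmannExp _ (isNilpotent_quadratic _ _), GrassmannAlgebra.coeffMap_quadratic,
    hmap]
  rfl

/-- **`∫dη̄dη e^{-S_A(ξ,η)} θF = e^{-ξAξ̄} · Γ_{Aᵀ}(F(φ+ξ, ψ))`**: the `η`-integral of the Gaussian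
times `θF` is the bosonic weight times the fermionic convolution of `F` with shifted coefficients.
[folklore] -/
theorem berezinOn_etaSet_superGauss_mul_thetaForm (A : Matrix Λ Λ ℂ) (F : SForm Λ) :
    berezinOn (FieldFun2 Λ) (etaSet Λ) (embedEta (superGauss A) * thetaForm F) =
      ofFun2 (fun p => Boson.gaussWeight A p.2) *
        gaussConvOn (FieldFun2 Λ) (blockPsi Λ) (blockEta Λ) (A.transpose.map (constHom₂ (Λ := Λ)))
          (mapPsi (coeffMap shiftCoeff F)) := by
  rw [embedEta_superGauss, mul_assoc, berezinOn_ofFun2_mul, mapEta_coeffMap_grassmannExp_neg_fermionAction]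
  rfl

/-- Monomials with constant coefficients. [folklore] -/
theorem grassmannBasis_eq_coeffMap_constHom₂ (T : Finset (DGen Λ)) :
    grassmannBasis (FieldFun2 Λ) (DGen Λ) T = coeffMap constHom₂ (grassmannBasis ℂ (DGen Λ) T) :=
  (GrassmannAlgebra.coeffMap_grassmannBasis _ T).symm

/-- The fermionic convolution of a monomial has the constant coefficients `fermiKernel`. [folklore] -/
theorem repr_gaussConvOn_grassmannBasis (A : Matrix Λ Λ ℂ) (T T' : Finset (DGen Λ)) :
    (grassmannBasis (FieldFun2 Λ) (DGen Λ)).repr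
        (gaussConvOn (FieldFun2 Λ) (blockPsi Λ) (blockEta Λ) (A.transpose.map (constHom₂ (Λ := Λ)))
          (grassmannBasis (FieldFun2 Λ) (DGen Λ) T)) T' =
      constHom₂ (fermiKernel A T T') := by
  rw [grassmannBasis_eq_coeffMap_constHom₂, ← coeffMap_gaussConvOn, GrassmannAlgebra.repr_coeffMap, fermiKernel]

/-- **The `ψ`-coefficients of `∫dη̄dη e^{-S_A} θF`**: at `(φ, ξ)`, the coefficient of `θ_s` is
`e^{-ξAξ̄} Σ_u f_u(φ+ξ) · fermiKernel A u s`. [folklore] -/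
theorem repr_berezinOn_etaSet_superGauss_mul_thetaForm (A : Matrix Λ Λ ℂ) (F : SForm Λ) (s : Finset (Λ ⊕ₗ Λ))
    (p : (Λ → ℂ) × (Λ → ℂ)) :
    (grassmannBasis (FieldFun2 Λ) (DGen Λ)).repr
        (berezinOn (FieldFun2 Λ) (etaSet Λ) (embedEta (superGauss A) * thetaForm F))
        (s.map (blockPsi Λ).toEmbedding) p =
      Boson.gaussWeight A p.2 * ∑ u : Finset (Λ ⊕ₗ Λ), (grassmannBasis (FieldFun Λ) (Λ ⊕ₗ Λ)).repr F u (p.1 + p.2) *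
        fermiKernel A (u.map (blockPsi Λ).toEmbedding) (s.map (blockPsi Λ).toEmbedding) := by
  have hF : mapPsi (coeffMap shiftCoeff F) = ∑ u : Finset (Λ ⊕ₗ Λ),
      shiftCoeff ((grassmannBasis (FieldFun Λ) (Λ ⊕ₗ Λ)).repr F u) •
        grassmannBasis (FieldFun2 Λ) (DGen Λ) (u.map (blockPsi Λ).toEmbedding) := by
    rw [GrassmannAlgebra.coeffMap_apply, map_sum]
    refine Finset.sum_congr rfl fun u _ => ?_
    rw [map_smul, mapPsi, GrassmannAlgebra.map_extendByZero_grassmannBasis]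
  rw [berezinOn_etaSet_superGauss_mul_thetaForm, hF, gaussConvOn_sum_smul, ofFun2, ← Algebra.smul_def, map_smul,
    map_sum]
  simp only [Finsupp.smul_apply, Finsupp.coe_finsetSum, Finset.sum_apply, map_smul, smul_eq_mul, Pi.mul_apply,
    repr_gaussConvOn_grassmannBasis, shiftCoeff_apply, constHom₂_apply]

/-- **The structure of `E_Cθ F` — eq. (4.22) for a general form**: if every coefficient `f_u` of `F`
has `ξ ↦ f_u(φ+ξ) e^{-ξAξ̄}` integrable and `det A ≠ 0`, then
`E_Cθ F = Σ_s (Σ_u ε (det A)⁻¹ fermiKernel A u s · (μ_C * f_u)) θ_s` (`μ_C * f = gaussConvolution A f`).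
[cite: BauerschmidtBrydgesSlade2015LogCorr, §4.1, eqs. (4.21)-(4.23)] -/
theorem convTheta_eq_sum (A : Matrix Λ Λ ℂ) (hA : A.det ≠ 0) (F : SForm Λ)
    (hint : ∀ (u : Finset (Λ ⊕ₗ Λ)) (φ : Λ → ℂ),
      Integrable fun ξ : Λ → ℂ => (grassmannBasis (FieldFun Λ) (Λ ⊕ₗ Λ)).repr F u (φ + ξ) * Boson.gaussWeight A ξ) :
    convTheta A F = ∑ s : Finset (Λ ⊕ₗ Λ),
      (fun φ => ∑ u : Finset (Λ ⊕ₗ Λ), orientSign Λ * (A.det)⁻¹ *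
        fermiKernel A (u.map (blockPsi Λ).toEmbedding) (s.map (blockPsi Λ).toEmbedding) *
          gaussConvolution A ((grassmannBasis (FieldFun Λ) (Λ ⊕ₗ Λ)).repr F u) φ) •
        grassmannBasis (FieldFun Λ) (Λ ⊕ₗ Λ) s := by
  rw [convTheta, fluctExpectation]
  refine Finset.sum_congr rfl fun s _ => ?_
  congr 1
  funext φ
  have hpi : (Real.pi : ℂ) ^ Fintype.card Λ ≠ 0 := pow_ne_zero _ (by exact_mod_cast Real.pi_ne_zero)
  simp only [fluctCoeffOf, repr_berezinOn_etaSet_superGauss_mul_thetaForm, Finset.mul_sum]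
  rw [integral_finsetSum _ fun u _ =>
    ((hint u φ).const_mul (fermiKernel A (u.map (blockPsi Λ).toEmbedding) (s.map (blockPsi Λ).toEmbedding))).congr
      (Filter.Eventually.of_forall fun ξ => by simp only; ring)]
  rw [Finset.mul_sum]
  refine Finset.sum_congr rfl fun u _ => ?_
  rw [show (fun ξ : Λ → ℂ => Boson.gaussWeight A ξ * ((grassmannBasis (FieldFun Λ) (Λ ⊕ₗ Λ)).repr F u (φ + ξ) *
      fermiKernel A (u.map (blockPsi Λ).toEmbedding) (s.map (blockPsi Λ).toEmbedding))) =
      fun ξ => fermiKernel A (u.map (blockPsi Λ).toEmbedding) (s.map (blockPsi Λ).toEmbedding) *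
        ((grassmannBasis (FieldFun Λ) (Λ ⊕ₗ Λ)).repr F u (φ + ξ) * Boson.gaussWeight A ξ) from
      funext fun ξ => by ring, integral_const_mul, gaussConvolution, inv_pow]
  field_simp

/-! #### The fermionic semigroup law for `fermiKernel` -/

/-- Sums over monomials of the doubled algebra supported away from the `η`-block are sums over the
`ψ`-monomials. [folklore] -/
theorem sum_eq_sum_map_blockPsi {M : Type*} [AddCommMonoid M] (g : Finset (DGen Λ) → M)
    (hg : ∀ T, ¬ Disjoint T (etaSet Λ) → g T = 0) :
    ∑ T, g T = ∑ s : Finset (Λ ⊕ₗ Λ), g (s.map (blockPsi Λ).toEmbedding) := by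
  classical
  set E : Finset (Λ ⊕ₗ Λ) ↪ Finset (DGen Λ) :=
    ⟨fun s => s.map (blockPsi Λ).toEmbedding, Finset.map_injective (blockPsi Λ).toEmbedding⟩ with hE
  have himage : ∀ T : Finset (DGen Λ), Disjoint T (etaSet Λ) → T ∈ Finset.univ.map E := by
    intro T hT
    refine Finset.mem_map.2 ⟨T.preimage (blockPsi Λ) (blockPsi Λ).injective.injOn, Finset.mem_univ _, ?_⟩
    change (T.preimage (blockPsi Λ) _).map (blockPsi Λ).toEmbedding = T
    rw [Finset.map_eq_image, RelEmbedding.coe_toEmbedding, Finset.image_preimage]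
    refine Finset.filter_true_of_mem fun j hj => ?_
    obtain ⟨k, rfl⟩ := eq_dblPsi_of_not_mem_dblEta Λ (j := j) (Finset.disjoint_left.1 hT hj)
    exact ⟨k, rfl⟩
  rw [← Finset.sum_subset (Finset.subset_univ (Finset.univ.map E)) fun T _ hT => hg T fun h => hT (himage T h),
    Finset.sum_map]
  rfl

omit [Fintype Λ] in
/-- `blockPsi`/`blockEta` are the blocks `dblPsi`/`dblEta` of `GrassmannGaussianConvolution.lean`. [folklore] -/
theorem blockPsi_eq_dblPsi : blockPsi Λ = dblPsi Λ := rfl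

omit [Fintype Λ] in
/-- `blockPsi`/`blockEta` are the blocks `dblPsi`/`dblEta` of `GrassmannGaussianConvolution.lean`. [folklore] -/
theorem blockEta_eq_dblEta : blockEta Λ = dblEta Λ := rfl

/-- **The semigroup law of the fermionic kernels**: for `A = convMatrix A₁ A₂`
(`A⁻¹ = A₁⁻¹ + A₂⁻¹`) and `T` a `ψ`-monomial,
`Σ_s fermiKernel A₁ T s · fermiKernel A₂ s T'' = ε det A₁ det A₂ (det A)⁻¹ · fermiKernel A T T''` —
`Γ_{A₂ᵀ} ∘ Γ_{A₁ᵀ} = (ε det A₁ det A₂/det A) Γ_{Aᵀ}` on matrix elements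
(`gaussConvOn_gaussConvOn_dbl`). [cite: BauerschmidtBrydgesSlade2015LogCorr, §5.1, Proposition 5.1] -/
theorem sum_fermiKernel_mul_fermiKernel {A₁ A₂ : Matrix Λ Λ ℂ} (h₁ : IsUnit A₁.det) (h₂ : IsUnit A₂.det)
    (hB : IsUnit (A₁ + A₂).det) {T : Finset (DGen Λ)} (hT : Disjoint T (etaSet Λ)) (T'' : Finset (DGen Λ)) :
    ∑ s : Finset (Λ ⊕ₗ Λ), fermiKernel A₁ T (s.map (blockPsi Λ).toEmbedding) *
        fermiKernel A₂ (s.map (blockPsi Λ).toEmbedding) T'' =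
      orientSign Λ * A₁.det * A₂.det * ((convMatrix A₁ A₂).det)⁻¹ * fermiKernel (convMatrix A₁ A₂) T T'' := by
  have hA : IsUnit (convMatrix A₁ A₂).det := by
    rw [convMatrix, Matrix.det_mul, Matrix.det_mul]
    exact (h₁.mul (Matrix.isUnit_nonsing_inv_det _ hB)).mul h₂
  have h₁' : IsUnit A₁.transpose.det := by rwa [Matrix.det_transpose]
  have h₂' : IsUnit A₂.transpose.det := by rwa [Matrix.det_transpose]
  have hA' : IsUnit (convMatrix A₁ A₂).transpose.det := by rwa [Matrix.det_transpose]
  have hinv : (convMatrix A₁ A₂).transpose⁻¹ = A₂.transpose⁻¹ + A₁.transpose⁻¹ := by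
    rw [← Matrix.transpose_nonsing_inv, inv_convMatrix h₁ h₂ hB, Matrix.transpose_add, ← Matrix.transpose_nonsing_inv,
      ← Matrix.transpose_nonsing_inv, add_comm]
  have hx : grassmannBasis ℂ (DGen Λ) T ∈ GrassmannAlgebra.spectatorSubalgebra ℂ (Finset.univ.map (dblEta Λ).toEmbedding) :=
    GrassmannAlgebra.grassmannBasis_mem_spectatorSubalgebra ℂ hT
  have key := congrArg (fun y => (grassmannBasis ℂ (DGen Λ)).repr y T'')
    (gaussConvOn_gaussConvOn_dbl ℂ A₂.transpose A₁.transpose (convMatrix A₁ A₂).transpose h₂' h₁' hA' hinv hx)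
  rw [← blockPsi_eq_dblPsi, ← blockEta_eq_dblEta, map_smul, Finsupp.smul_apply, smul_eq_mul, Matrix.det_transpose,
    Matrix.det_transpose, Matrix.det_transpose, Ring.inverse_eq_inv'] at key
  -- expand the inner convolution in the monomial basis
  conv_lhs at key =>
    rw [← (grassmannBasis ℂ (DGen Λ)).sum_repr
      (gaussConvOn ℂ (blockPsi Λ) (blockEta Λ) A₁.transpose (grassmannBasis ℂ (DGen Λ) T)), gaussConvOn_sum_smul,
      map_sum, Finsupp.coe_finsetSum, Finset.sum_apply]
  rw [sum_eq_sum_map_blockPsi _ fun T' hT' => by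
    rw [map_smul, Finsupp.smul_apply, show (grassmannBasis ℂ (DGen Λ)).repr
      (gaussConvOn ℂ (blockPsi Λ) (blockEta Λ) A₁.transpose (grassmannBasis ℂ (DGen Λ) T)) T' = 0 from
      repr_gaussConvOn_eq_zero _ _ _ _ hT', zero_smul]] at key
  simp only [map_smul, Finsupp.smul_apply, smul_eq_mul] at key
  rw [show orientSign Λ * A₁.det * A₂.det * ((convMatrix A₁ A₂).det)⁻¹ =
      (-1 : ℂ) ^ (Fintype.card Λ * (Fintype.card Λ - 1) / 2) * A₂.det * A₁.det * ((convMatrix A₁ A₂).det)⁻¹ by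
    rw [orientSign]; ring]
  exact key

/-! #### Integrability -/

variable {A₁ A₂ : Matrix Λ Λ ℂ} {c₁ c₂ : ℝ}

/-- `ξ ↦ f(φ+ξ) e^{-ξAξ̄}` is integrable for `f` continuous of polynomial growth. [folklore] -/
theorem integrable_shift_mul_gaussWeight {A : Matrix Λ Λ ℂ} {c : ℝ} (h : RealPosDef A c) {f : FieldFun Λ}
    (hf : Continuous f) {K : ℝ} {k : ℕ} (hfb : ∀ x, ‖f x‖ ≤ K * (1 + ‖x‖) ^ k) (φ : Λ → ℂ) :
    Integrable fun ξ : Λ → ℂ => f (φ + ξ) * Boson.gaussWeight A ξ := by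
  have hK : 0 ≤ K := by
    have := hfb 0
    have h0 : (0 : ℝ) ≤ ‖f 0‖ := norm_nonneg _
    simp at this
    linarith
  refine Boson.integrable_mul_gaussWeight h.pos h.bound (F := fun ξ => f (φ + ξ))
    ((hf.comp (continuous_const.add continuous_id)).aestronglyMeasurable) (M := K * (1 + ‖φ‖) ^ k) (k := k)
    fun ξ => ?_
  calc ‖f (φ + ξ)‖ ≤ K * (1 + ‖φ + ξ‖) ^ k := hfb _
    _ ≤ K * ((1 + ‖φ‖) * (1 + ‖ξ‖)) ^ k := by
        refine mul_le_mul_of_nonneg_left (pow_le_pow_left₀ (by positivity) ?_ k) hK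
        nlinarith [norm_add_le φ ξ, norm_nonneg φ, norm_nonneg ξ, mul_nonneg (norm_nonneg φ) (norm_nonneg ξ)]
    _ = K * (1 + ‖φ‖) ^ k * (1 + ‖ξ‖) ^ k := by rw [mul_pow]; ring

/-- `ξ₂ ↦ (μ_{C₁} * f)(φ+ξ₂) e^{-ξ₂A₂ξ̄₂}` is integrable. [folklore] -/
theorem integrable_gaussConvolution_shift_mul_gaussWeight (h₁ : RealPosDef A₁ c₁) (h₂ : RealPosDef A₂ c₂)
    {f : FieldFun Λ} (hf : Continuous f) {K : ℝ} {k : ℕ} (hfb : ∀ x, ‖f x‖ ≤ K * (1 + ‖x‖) ^ k) (φ : Λ → ℂ) :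
    Integrable fun ξ₂ : Λ → ℂ => gaussConvolution A₁ f (φ + ξ₂) * Boson.gaussWeight A₂ ξ₂ := by
  have hF₀ := (integrable_shift_mul_gaussWeight_prod h₁ h₂ hf hfb φ).integral_prod_left
  refine (hF₀.const_mul (A₁.det / (Real.pi : ℂ) ^ Fintype.card Λ)).congr (Filter.Eventually.of_forall fun ξ₂ => ?_)
  simp only [gaussConvolution]
  rw [mul_assoc, ← integral_mul_const]

/-- `ξ ↦ f(φ+ξ) e^{-ξAξ̄}` is integrable for the composed kinetic matrix `A = convMatrix A₁ A₂`
(via `e^{-ξAξ̄} = Z_{A₁+A₂}⁻¹ ∫ e^{-(ξ-ξ₂)A₁(ξ̄-ξ̄₂)} e^{-ξ₂A₂ξ̄₂} dξ₂` and the shear). [folklore] -/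
theorem integrable_shift_mul_gaussWeight_convMatrix (h₁ : RealPosDef A₁ c₁) (h₂ : RealPosDef A₂ c₂)
    {f : FieldFun Λ} (hf : Continuous f) {K : ℝ} {k : ℕ} (hfb : ∀ x, ‖f x‖ ≤ K * (1 + ‖x‖) ^ k) (φ : Λ → ℂ) :
    Integrable fun ξ : Λ → ℂ => f (φ + ξ) * Boson.gaussWeight (convMatrix A₁ A₂) ξ := by
  have hB : RealPosDef (A₁ + A₂) (c₁ + c₂) := h₁.add h₂
  have hpi : (Real.pi : ℂ) ^ Fintype.card Λ ≠ 0 := pow_ne_zero _ (by exact_mod_cast Real.pi_ne_zero)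
  have hZ : Boson.partitionFn (A₁ + A₂) ≠ 0 := by
    rw [partitionFn_eq hB.pos hB.bound]
    exact div_ne_zero hpi hB.isUnit_det.ne_zero
  set F₀ : (Λ → ℂ) × (Λ → ℂ) → ℂ := fun z => f (φ + z.1 + z.2) * Boson.gaussWeight A₁ z.2 * Boson.gaussWeight A₂ z.1
    with hF₀
  set Kf : (Λ → ℂ) × (Λ → ℂ) → ℂ := fun z => f (φ + z.2) * (Boson.gaussWeight A₁ (z.2 - z.1) * Boson.gaussWeight A₂ z.1)
    with hKf
  have hshear : MeasurePreserving (fun z : (Λ → ℂ) × (Λ → ℂ) => (z.1, z.1 + z.2))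
      ((volume : Measure (Λ → ℂ)).prod volume) ((volume : Measure (Λ → ℂ)).prod volume) :=
    measurePreserving_prod_add volume volume
  have hemb : MeasurableEmbedding (fun z : (Λ → ℂ) × (Λ → ℂ) => (z.1, z.1 + z.2)) :=
    (MeasurableEquiv.shearAddRight (Λ → ℂ)).measurableEmbedding
  have hcomp : ∀ z : (Λ → ℂ) × (Λ → ℂ), F₀ z = Kf (z.1, z.1 + z.2) := by
    intro z; simp only [hF₀, hKf, add_sub_cancel_left, add_assoc]; ring
  have hKint : Integrable Kf ((volume : Measure (Λ → ℂ)).prod volume) := by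
    rw [← hshear.integrable_comp_emb hemb (g := Kf)]
    exact (integrable_shift_mul_gaussWeight_prod h₁ h₂ hf hfb φ).congr (Filter.Eventually.of_forall hcomp)
  have hint := hKint.integral_prod_right
  have heq : ∀ ξ : Λ → ℂ, ∫ ξ₂ : Λ → ℂ, Kf (ξ₂, ξ) =
      Boson.partitionFn (A₁ + A₂) * (f (φ + ξ) * Boson.gaussWeight (convMatrix A₁ A₂) ξ) := by
    intro ξ
    simp only [hKf]
    rw [integral_const_mul, integral_gaussWeight_sub_mul_gaussWeight h₁ h₂ ξ]
    ring
  have hint' : Integrable fun ξ : Λ → ℂ =>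
      Boson.partitionFn (A₁ + A₂) * (f (φ + ξ) * Boson.gaussWeight (convMatrix A₁ A₂) ξ) :=
    hint.congr (Filter.Eventually.of_forall heq)
  refine (hint'.const_mul (Boson.partitionFn (A₁ + A₂))⁻¹).congr (Filter.Eventually.of_forall fun ξ => ?_)
  simp only
  rw [← mul_assoc, inv_mul_cancel₀ hZ, one_mul]

/-- `μ_C *` is linear on finite combinations (integrable terms). [folklore] -/
theorem gaussConvolution_sum_mul {α : Type*} (S : Finset α) (c : α → ℂ) (g : α → FieldFun Λ) (A : Matrix Λ Λ ℂ)
    (φ : Λ → ℂ) (hg : ∀ u ∈ S, Integrable fun ξ : Λ → ℂ => g u (φ + ξ) * Boson.gaussWeight A ξ) :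
    gaussConvolution A (fun φ' => ∑ u ∈ S, c u * g u φ') φ = ∑ u ∈ S, c u * gaussConvolution A (g u) φ := by
  simp only [gaussConvolution, Finset.sum_mul]
  rw [integral_finsetSum _ fun u hu => ((hg u hu).const_mul (c u)).congr
    (Filter.Eventually.of_forall fun ξ => by simp only; ring), Finset.mul_sum]
  refine Finset.sum_congr rfl fun u _ => ?_
  rw [show (fun ξ : Λ → ℂ => c u * g u (φ + ξ) * Boson.gaussWeight A ξ) =
      fun ξ => c u * (g u (φ + ξ) * Boson.gaussWeight A ξ) from funext fun ξ => by ring, integral_const_mul]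
  ring

/-- Coordinates of an explicit expansion. [folklore] -/
theorem repr_sum_smul_grassmannBasis (c : Finset (Λ ⊕ₗ Λ) → FieldFun Λ) (t : Finset (Λ ⊕ₗ Λ)) :
    (grassmannBasis (FieldFun Λ) (Λ ⊕ₗ Λ)).repr (∑ s, c s • grassmannBasis (FieldFun Λ) (Λ ⊕ₗ Λ) s) t = c t := by
  classical
  simp only [map_sum, map_smul, Module.Basis.repr_self, Finsupp.coe_finsetSum, Finset.sum_apply,
    Finsupp.smul_apply, Finsupp.single_apply, smul_eq_mul, mul_ite, mul_one, mul_zero, Finset.sum_ite_eq',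
    Finset.mem_univ, if_true]

/-- The `ψ`-monomials avoid the `η`-block. [folklore] -/
theorem disjoint_map_blockPsi_etaSet (u : Finset (Λ ⊕ₗ Λ)) : Disjoint (u.map (blockPsi Λ).toEmbedding) (etaSet Λ) := by
  refine Finset.disjoint_left.2 fun j hj hj' => ?_
  obtain ⟨k, -, rfl⟩ := Finset.mem_map.1 hj
  exact blockPsi_not_mem_etaSet k hj'

/-- **BBS 2015, Proposition 5.1: `E_{C₂}θ (E_{C₁}θ F) = E_{C₁+C₂}θ F`** for the Gaussian
super-convolution `E_Cθ = convTheta A` (`C = A⁻¹`), real symmetric positive-definite `A₁, A₂`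
(`C₁ + C₂ = (convMatrix A₁ A₂)⁻¹`, `inv_convMatrix`), and every form `F ∈ 𝒩` whose coefficients are
continuous of polynomial growth: the elementary fact that sums of independent Gaussians are Gaussian,
for bosons (`gaussConvolution_gaussConvolution`) and fermions (`sum_fermiKernel_mul_fermiKernel`) at once.
[cite: BauerschmidtBrydgesSlade2015LogCorr, §5.1, Proposition 5.1] -/
theorem convTheta_convTheta (h₁ : RealPosDef A₁ c₁) (h₂ : RealPosDef A₂ c₂) {F : SForm Λ}
    (hFc : ∀ u, Continuous ((grassmannBasis (FieldFun Λ) (Λ ⊕ₗ Λ)).repr F u))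
    (hFb : ∀ u, ∃ K : ℝ, ∃ k : ℕ, ∀ x, ‖(grassmannBasis (FieldFun Λ) (Λ ⊕ₗ Λ)).repr F u x‖ ≤ K * (1 + ‖x‖) ^ k) :
    convTheta A₂ (convTheta A₁ F) = convTheta (convMatrix A₁ A₂) F := by
  have hB : RealPosDef (A₁ + A₂) (c₁ + c₂) := h₁.add h₂
  have hdet₁ : A₁.det ≠ 0 := h₁.isUnit_det.ne_zero
  have hdet₂ : A₂.det ≠ 0 := h₂.isUnit_det.ne_zero
  have hAu : IsUnit (convMatrix A₁ A₂).det := by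
    rw [convMatrix, Matrix.det_mul, Matrix.det_mul]
    exact (h₁.isUnit_det.mul (Matrix.isUnit_nonsing_inv_det _ hB.isUnit_det)).mul h₂.isUnit_det
  have hε : orientSign Λ * orientSign Λ = 1 := orientSign_mul_self Λ
  -- integrability of the three families of coefficients
  have hI1 : ∀ (u : Finset (Λ ⊕ₗ Λ)) (φ : Λ → ℂ), Integrable fun ξ : Λ → ℂ =>
      (grassmannBasis (FieldFun Λ) (Λ ⊕ₗ Λ)).repr F u (φ + ξ) * Boson.gaussWeight A₁ ξ := fun u φ => by
    obtain ⟨K, k, hk⟩ := hFb u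
    exact integrable_shift_mul_gaussWeight h₁ (hFc u) hk φ
  have hI3 : ∀ (u : Finset (Λ ⊕ₗ Λ)) (φ : Λ → ℂ), Integrable fun ξ : Λ → ℂ =>
      (grassmannBasis (FieldFun Λ) (Λ ⊕ₗ Λ)).repr F u (φ + ξ) * Boson.gaussWeight (convMatrix A₁ A₂) ξ := fun u φ => by
    obtain ⟨K, k, hk⟩ := hFb u
    exact integrable_shift_mul_gaussWeight_convMatrix h₁ h₂ (hFc u) hk φ
  have hIg : ∀ (u : Finset (Λ ⊕ₗ Λ)) (φ : Λ → ℂ), Integrable fun ξ₂ : Λ → ℂ =>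
      gaussConvolution A₁ ((grassmannBasis (FieldFun Λ) (Λ ⊕ₗ Λ)).repr F u) (φ + ξ₂) * Boson.gaussWeight A₂ ξ₂ :=
    fun u φ => by
    obtain ⟨K, k, hk⟩ := hFb u
    exact integrable_gaussConvolution_shift_mul_gaussWeight h₁ h₂ (hFc u) hk φ
  rw [convTheta_eq_sum A₁ hdet₁ F hI1]
  -- the coefficients of the intermediate form `E_{C₁}θ F`
  set y : Finset (Λ ⊕ₗ Λ) → FieldFun Λ := fun s φ => ∑ u : Finset (Λ ⊕ₗ Λ), orientSign Λ * (A₁.det)⁻¹ *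
      fermiKernel A₁ (u.map (blockPsi Λ).toEmbedding) (s.map (blockPsi Λ).toEmbedding) *
        gaussConvolution A₁ ((grassmannBasis (FieldFun Λ) (Λ ⊕ₗ Λ)).repr F u) φ with hy
  have hreprY : ∀ s, (grassmannBasis (FieldFun Λ) (Λ ⊕ₗ Λ)).repr
      (∑ s, y s • grassmannBasis (FieldFun Λ) (Λ ⊕ₗ Λ) s) s = y s := repr_sum_smul_grassmannBasis y
  have hI2 : ∀ (s : Finset (Λ ⊕ₗ Λ)) (φ : Λ → ℂ), Integrable fun ξ : Λ → ℂ =>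
      (grassmannBasis (FieldFun Λ) (Λ ⊕ₗ Λ)).repr (∑ s, y s • grassmannBasis (FieldFun Λ) (Λ ⊕ₗ Λ) s) s (φ + ξ) *
        Boson.gaussWeight A₂ ξ := by
    intro s φ
    simp only [hreprY]
    simp only [hy, Finset.sum_mul]
    exact integrable_finsetSum _ fun u _ => ((hIg u φ).const_mul (orientSign Λ * (A₁.det)⁻¹ *
      fermiKernel A₁ (u.map (blockPsi Λ).toEmbedding) (s.map (blockPsi Λ).toEmbedding))).congr
      (Filter.Eventually.of_forall fun ξ => by simp only; ring)
  rw [convTheta_eq_sum A₂ hdet₂ _ hI2, convTheta_eq_sum (convMatrix A₁ A₂) hAu.ne_zero F hI3]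
  refine Finset.sum_congr rfl fun t _ => ?_
  congr 1
  funext φ
  simp only [hreprY]
  -- bosons: `μ_{C₂} * (μ_{C₁} * f) = μ_{C₁+C₂} * f`; fermions: the kernel semigroup law
  have hbos : ∀ s : Finset (Λ ⊕ₗ Λ), gaussConvolution A₂ (y s) φ =
      ∑ u : Finset (Λ ⊕ₗ Λ), orientSign Λ * (A₁.det)⁻¹ *
        fermiKernel A₁ (u.map (blockPsi Λ).toEmbedding) (s.map (blockPsi Λ).toEmbedding) *
          gaussConvolution (convMatrix A₁ A₂) ((grassmannBasis (FieldFun Λ) (Λ ⊕ₗ Λ)).repr F u) φ := by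
    intro s
    rw [hy, gaussConvolution_sum_mul _ _ _ A₂ φ fun u _ => hIg u φ]
    refine Finset.sum_congr rfl fun u _ => ?_
    obtain ⟨K, k, hk⟩ := hFb u
    rw [gaussConvolution_gaussConvolution h₁ h₂ (hFc u) hk φ]
  simp_rw [hbos, Finset.mul_sum]
  rw [Finset.sum_comm]
  refine Finset.sum_congr rfl fun u _ => ?_
  have hK := sum_fermiKernel_mul_fermiKernel h₁.isUnit_det h₂.isUnit_det hB.isUnit_det
    (disjoint_map_blockPsi_etaSet u) (t.map (blockPsi Λ).toEmbedding)
  calc ∑ s : Finset (Λ ⊕ₗ Λ), orientSign Λ * (A₂.det)⁻¹ *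
        fermiKernel A₂ (s.map (blockPsi Λ).toEmbedding) (t.map (blockPsi Λ).toEmbedding) *
        (orientSign Λ * (A₁.det)⁻¹ * fermiKernel A₁ (u.map (blockPsi Λ).toEmbedding) (s.map (blockPsi Λ).toEmbedding) *
          gaussConvolution (convMatrix A₁ A₂) ((grassmannBasis (FieldFun Λ) (Λ ⊕ₗ Λ)).repr F u) φ)
      = orientSign Λ * orientSign Λ * ((A₁.det)⁻¹ * (A₂.det)⁻¹) *
          (∑ s : Finset (Λ ⊕ₗ Λ), fermiKernel A₁ (u.map (blockPsi Λ).toEmbedding) (s.map (blockPsi Λ).toEmbedding) *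
            fermiKernel A₂ (s.map (blockPsi Λ).toEmbedding) (t.map (blockPsi Λ).toEmbedding)) *
          gaussConvolution (convMatrix A₁ A₂) ((grassmannBasis (FieldFun Λ) (Λ ⊕ₗ Λ)).repr F u) φ := by
        rw [Finset.mul_sum, Finset.sum_mul]
        exact Finset.sum_congr rfl fun s _ => by ring
    _ = orientSign Λ * ((convMatrix A₁ A₂).det)⁻¹ *
          fermiKernel (convMatrix A₁ A₂) (u.map (blockPsi Λ).toEmbedding) (t.map (blockPsi Λ).toEmbedding) *
          gaussConvolution (convMatrix A₁ A₂) ((grassmannBasis (FieldFun Λ) (Λ ⊕ₗ Λ)).repr F u) φ := by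
        rw [hK, hε]
        field_simp

end Progressive

end CTWSAW

end Literature.Barriers.CriticalPhenomena
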